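import Literature.IUT.HodgeArakelov.StableCurveAgreementPiDictionary
import Literature.IUT.HodgeArakelov.LabelClassesOfCuspsRmk231Proofs
import Literature.IUT.HodgeArakelov.PlusMinusTowerPiVIndex
import Literature.IUT.HodgeArakelov.PlusMinusTowerPiVNormal
import HarnessLib

/-!
# [IUTchII] Def 2.3 (i): abc-iut-L6-t1's `Def23_i_indices` PRODUCED at the decomposition subgroups cut out by [IUTchI] §2 data

S. Mochizuki, *Inter-universal Teichmüller Theory II*, kurims manuscript (Dec. 2020), §2, Def 2.3 (i) p. 67: «we shall write
`Π^±_{v•} := N_{Π^±_v}(Π_{v•}) ⊆ Π^±_{v▶} := N_{Π^±_v}(Π_{v▶}) ⊆ Π^±_v` … Thus, we obtain natural isomorphisms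
`Π^±_{v•}/Π_{v•} ⥲ Π^±_{v▶}/Π_{v▶} ⥲ Π^±_v/Π_v ⥲ Δ̂^±_v/Δ̂_v ⥲ Gal(X̲̲_v/X_v) (≅ ℤ/lℤ)` and equalities `Π^±_{v•} ∩ Π_v = Π_{v•}`,
`Π^±_{v▶} ∩ Π_v = Π_{v▶}` [cf. [IUTchI], Corollary 2.3, (iv)]»; Rmk 2.1.1 (ii) p. 65 («the degree `l` covering … is totally ramified at the
cusps»); *Inter-universal Teichmüller Theory I* (May 2020), §2, Cor 2.3 (iii)(iv)(vi) pp. 47–48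
[cite: Mochizuki2012, II Def 2.3 (i) p.67, II Rmk 2.1.1 (ii) p.65; I Cor 2.3 (iii)(iv)(vi) pp.47–48] (D-0012 claim key, status disputed; every
printed statement of the series is a HYPOTHESIS named by the tree's predicates — nothing of the series is asserted).  abc-iut cell, seat
abc-iut-w5-d132 (gen 5); node **IUTchII:Def2.3(i)** (abc-iut-L6-t1's predicate `Def23_i_indices Dec W`, consumed by the Cor 2.4 (ii)
assemblies `LabelClassesOfCuspsCor24iiAssembly*` and by abc-iut-L6-t19's `rmk231_powers_piV_of_def23_i_indices`); sequel to this seat's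
`StableCurveAgreementPiDictionary` (p437206).  PROOF-ONLY (no `def`, no `structure`, no `instance`).

THE POINT.  `Def23_i_indices Dec W` says, for `H ∈ {Π_{v•}, Π_{v▶}}` (= `Dec.Pbullet`, `Dec.Ptri`): (1) `Π^±_{v□} ∩ Π_v = Π_{v□}`,
(2) `[Π^±_{v□} : Π_{v□}] = l`, (3) `[Π^±_v : Π_v] = l`.  For the decomposition subgroup CUT OUT BY an [IUTchI] §2 datum `D` through an
identification `φ : Π^tp_{X_v}(P) ⥲ Π^tp_X`, `H▶ := incl⁻¹(φ⁻¹ Π^tp_{X,ℍ})` («`Π_{v▶} := Π_v ∩ Π^tp_{X_v,ℍ}`»), clause (1) is p437206's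
`pmBox_comap_inf_piV` ([IUTchI] Cor 2.3 (iv) BY NAME); clause (2) is PROVED here: `Π^±_{v▶} = φ⁻¹ Π^tp_{X,ℍ}` (p437206 `pmBox_comap_eq`) is NOT
contained in the normal subgroup `Π_v` of prime index `l` — because `ℍ` meets a cusp `x` ([IUTchI] Cor 2.3 (vi): `I_x ⊆ Δ^tp_{X,ℍ}` up to
`Δ^tp_X`-conjugacy) at which `X̲̲_v → X_v` is RAMIFIED (`I_x ⊄ Π_v`, Rmk 2.1.1 (ii) «totally ramified at the cusps») — so its image in
`Π^±_v/Π_v ≅ ℤ/lℤ` is everything (abc-iut-L6-t19's `relIndex_eq_of_prime_relIndex_of_not_le`, p417290); clause (3) is `[Π^tp_{X_v}(P) : incl P] = l`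
(abc-iut-L6-t19 `index_piV_subgroupOf_piPM`).  NO agreement / `±`-tower completion data is needed: everything is read in `Π^tp_{X_v}(P)`.

* `StableCurveAgreement.not_comap_piTpXH_le_of_ramified_cusp` — `φ⁻¹ Π^tp_{X,ℍ} ⊄ incl Π_v` from: `Π_v ⊴`, [IUTchI] Cor 2.3 (vi) (`D.Cor23vi`, BY
  NAME), a cusp `x` with `cuspMeetsH x`, and «`X̲̲_v → X_v` ramified at `x`» (`φ⁻¹ I_x ⊄ incl Π_v`, INLINE hypothesis — the model property of
  Rmk 2.1.1 (ii), owner L2/L5; nothing new is declared);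
* `StableCurveAgreement.index_box_subgroupOf_pmBox_comap` — clause (2) «`[Π^±_{v▶} : Π_{v▶}] = l`» at `H▶`;
* **`def23_i_indices_of_comap`** — `Def23_i_indices Dec W` for EVERY tower `W` and EVERY subgraph decomposition `Dec` whose `Π_{v▶}`, `Π_{v•}`
  ARE the decomposition subgroups cut out by two [IUTchI] §2 data `D▶`, `D•` (identification hypotheses `htri`, `hbul` — the MERGE
  identification of plan/L6/MERGE-MAP.md, explicit, NOT claimed), modulo per datum: `Cor23Hyp`, [IUTchI] Cor 2.3 (iv), and
  `φ⁻¹ Π^tp_{X,ℍ} ⊄ incl Π_v` (or its cusp form above); plus `incl Π_v ⊴ Π^tp_{X_v}(P)` of index `l` (theorems at the genuine settings: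
  p437935 `range_incl_normal_ofUnderline`, abc-iut-L2-t8 `ofUnderline_index_eq`).

HONEST LABEL: kernel theorems about ANY tower; the identification hypotheses and the L5 nodes are named inputs; the ramification input is
the printed model property, stated inline.  Nothing of the series is asserted; witnessed ≠ endorsed; no side taken on [IUTchIII] Cor 3.12.
-/

namespace Literature.IUT.HodgeArakelov

open Literature.IUT.HodgeTheaters
open scoped Pointwise

universe u

variable {S : BadPlaceSetting.{u}} {P : TopGroup.{u}} {T : TemperedCoverings S P}

namespace PlusMinusTower

namespace StableCurveAgreement

variable {D : StableCurveTemperedData.{u}}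

/-- **IUTchI:Cor2.3(vi)** (kurims p.48) / **IUTchII:Rmk2.1.1(ii)** (kurims p.65) **`Π^tp_{X,ℍ} ⊄ Π_v`.**  If `incl Π_v ⊴ Π^tp_{X_v}(P)`, `ℍ` meets a cusp
`x` ([IUTchI] Cor 2.3 (vi), `D.Cor23vi`, BY NAME: `I_x ⊆ Δ^tp_{X,ℍ}` up to `Δ^tp_X`-conjugacy) and `X̲̲_v → X_v` is ramified at `x`
(`φ⁻¹ I_x ⊄ incl Π_v`, INLINE), then `φ⁻¹ Π^tp_{X,ℍ} ⊄ incl Π_v`.  PROVED. [claim: Mochizuki2012, status: disputed] -/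
theorem not_comap_piTpXH_le_of_ramified_cusp (φ : T.Xplain ≃* D.PiTp) (hN : T.incl.range.Normal)
    (h23vi : D.Cor23vi) (x : D.Cusp) (hx : D.cuspMeetsH x)
    (hram : ¬ ((D.inertiaTp x).map D.DeltaTp.subtype).comap φ.toMonoidHom ≤ T.incl.range) :
    ¬ D.piTpXH.comap φ.toMonoidHom ≤ T.incl.range := by
  intro hle
  apply hram
  obtain ⟨d, hd⟩ := (h23vi.tp x).mpr hx
  intro y hy
  rw [Subgroup.mem_comap] at hy
  obtain ⟨i, hi, hiy⟩ := hy
  -- `d⁻¹ i d ∈ Δ^tp_{X,ℍ} ⊆ Π^tp_{X,ℍ}`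
  have hz : (MulAut.conj d)⁻¹ • i ∈ D.deltaTpH := by
    have := hd hi
    rwa [Subgroup.mem_pointwise_smul_iff_inv_smul_mem] at this
  rw [MulAut.smul_def, MulAut.conj_inv_apply] at hz
  have hzX : ((d⁻¹ * i * d : D.DeltaTp) : D.PiTp) ∈ D.piTpXH := Subgroup.le_normalizer ⟨_, hz, rfl⟩
  have h1 : φ.symm ((d⁻¹ * i * d : D.DeltaTp) : D.PiTp) ∈ T.incl.range := by
    apply hle
    rw [Subgroup.mem_comap, MulEquiv.coe_toMonoidHom, MulEquiv.apply_symm_apply]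
    exact hzX
  -- `y = φ⁻¹(d) · φ⁻¹(d⁻¹ i d) · φ⁻¹(d)⁻¹`, so `y ∈ incl Π_v` by normality
  have hy' : y = φ.symm (d : D.PiTp) * φ.symm ((d⁻¹ * i * d : D.DeltaTp) : D.PiTp) * (φ.symm (d : D.PiTp))⁻¹ := by
    apply φ.injective
    have hiy' : (i : D.PiTp) = φ y := hiy
    rw [map_mul, map_mul, map_inv, MulEquiv.apply_symm_apply, MulEquiv.apply_symm_apply, ← hiy']
    simp only [Subgroup.coe_mul, Subgroup.coe_inv]
    group
  rw [hy']
  exact hN.conj_mem _ h1 _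

/-- **IUTchII:Def2.3(i)** (kurims p.67) **Clause (2) «`Π^±_{v▶}/Π_{v▶} ⥲ Π^±_v/Π_v (≅ ℤ/lℤ)`», i.e. `[Π^±_{v▶} : Π_{v▶}] = l`, at `H▶ := incl⁻¹(φ⁻¹ Π^tp_{X,ℍ})`:**
from `incl Π_v ⊴ Π^tp_{X_v}(P)` of prime index `l = S.l`, [IUTchI] Cor 2.3 (iv) of `D` (under `Cor23Hyp`, BY NAME) and `φ⁻¹ Π^tp_{X,ℍ} ⊄ incl Π_v`
(`not_comap_piTpXH_le_of_ramified_cusp`).  PROVED (p437206 `pmBox_comap_eq`/`box_comap_eq` + abc-iut-L6-t19's `relIndex_eq_of_prime_relIndex_of_not_le`).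
[claim: Mochizuki2012, status: disputed] -/
theorem index_box_subgroupOf_pmBox_comap (W : PlusMinusTower T) (φ : T.Xplain ≃* D.PiTp) (hN : T.incl.range.Normal)
    (hIl : T.incl.range.index = S.l) (hHyp : D.Cor23Hyp) (h23iv : D.Cor23iv)
    (hnot : ¬ D.piTpXH.comap φ.toMonoidHom ≤ T.incl.range) :
    ((W.box ((D.piTpXH.comap φ.toMonoidHom).comap T.incl)).subgroupOf
        (W.pmBox ((D.piTpXH.comap φ.toMonoidHom).comap T.incl))).index = S.l := by
  haveI := hN
  have hI : T.incl.range.index ≠ 0 := by rw [hIl]; exact S.l_prime.ne_zero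
  change (W.box _).relIndex (W.pmBox _) = _
  rw [pmBox_comap_eq φ hN hI hHyp h23iv, box_comap_eq, Subgroup.relIndex_map_map_of_injective _ _ W.emb_injective,
    Subgroup.inf_relIndex_left]
  exact relIndex_eq_of_prime_relIndex_of_not_le (B := ⊤) S.l_prime
    (by rw [Subgroup.relIndex_top_right, hIl]) le_top hnot

end StableCurveAgreement

/-- **IUTchII:Def2.3(i)** (kurims p.67) **abc-iut-L6-t1's `Def23_i_indices Dec W` PRODUCED** for EVERY `±`-tower `W` and EVERY subgraph decomposition `Dec` whose
`Π_{v▶}`, `Π_{v•}` ARE the decomposition subgroups cut out by [IUTchI] §2 data `D▶`, `D•` through identifications `φ▶`, `φ•` (hypotheses `htri`,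
`hbul` — the MERGE identification, explicit), MODULO per datum: `Cor23Hyp`, [IUTchI] Cor 2.3 (iv), and «`φ⁻¹ Π^tp_{X,ℍ} ⊄ incl Π_v`» (cusp form:
`not_comap_piTpXH_le_of_ramified_cusp`); plus `incl Π_v ⊴ Π^tp_{X_v}(P)` of index `l`.  All three printed clauses — «`Π^±_{v□} ∩ Π_v = Π_{v□}`»,
«`Π^±_{v□}/Π_{v□} ≅ ℤ/lℤ`», «`Π^±_v/Π_v ≅ ℤ/lℤ`» — for `□ ∈ {•, ▶}`.  PROVED. [claim: Mochizuki2012, status: disputed] -/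
theorem def23_i_indices_of_comap {E : EtaleThetaData S.toThetaSetting P} (Dec : SubgraphDecomposition S T E)
    (W : PlusMinusTower T) (hN : T.incl.range.Normal) (hIl : T.incl.range.index = S.l)
    {Dtri Dbul : StableCurveTemperedData.{u}} (φtri : T.Xplain ≃* Dtri.PiTp) (φbul : T.Xplain ≃* Dbul.PiTp)
    (htri : Dec.Ptri = (Dtri.piTpXH.comap φtri.toMonoidHom).comap T.incl)
    (hbul : Dec.Pbullet = (Dbul.piTpXH.comap φbul.toMonoidHom).comap T.incl)
    (hHyp_tri : Dtri.Cor23Hyp) (h23iv_tri : Dtri.Cor23iv) (hnot_tri : ¬ Dtri.piTpXH.comap φtri.toMonoidHom ≤ T.incl.range)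
    (hHyp_bul : Dbul.Cor23Hyp) (h23iv_bul : Dbul.Cor23iv) (hnot_bul : ¬ Dbul.piTpXH.comap φbul.toMonoidHom ≤ T.incl.range) :
    Def23_i_indices Dec W := by
  have hI : T.incl.range.index ≠ 0 := by rw [hIl]; exact S.l_prime.ne_zero
  have h3 : (W.piV.subgroupOf W.piPM).index = S.l := by rw [W.index_piV_subgroupOf_piPM, hIl]
  intro H hH
  rcases hH with rfl | rfl
  · rw [hbul]
    exact ⟨StableCurveAgreement.pmBox_comap_inf_piV φbul hN hI hHyp_bul h23iv_bul,
      StableCurveAgreement.index_box_subgroupOf_pmBox_comap W φbul hN hIl hHyp_bul h23iv_bul hnot_bul, h3⟩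
  · rw [htri]
    exact ⟨StableCurveAgreement.pmBox_comap_inf_piV φtri hN hI hHyp_tri h23iv_tri,
      StableCurveAgreement.index_box_subgroupOf_pmBox_comap W φtri hN hIl hHyp_tri h23iv_tri hnot_tri, h3⟩

end PlusMinusTower

/-! ### Over the print-level setting `BadPlaceSetting.ofUnderline` (`Π_v = Π^tp_{X̲̲_v} ⊆ Π^tp_{X̲_v}`): `Π_v ⊴ Π^±_v` of index `l` are theorems -/

section Genuine

open Literature.AnabelianGeometry.EtaleTheta

variable {p : ℕ} [Fact p.Prime] {M : Literature.AnabelianGeometry.EtaleTheta.ThetaSetting p}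
  {E : M.EtaleThetaData} {l : ℕ} (C : E.DoubleUnderline l) {N : ℕ+}
  (μ : M.CyclotomeMod l N) (hC : M.Compat) (hS : M.Sec2Hyps) (hl : l.Prime) (hp2 : p ≠ 2) (hpl : p ≠ l)
  (hζ : ∃ ζ : M.K, IsPrimitiveRoot ζ (4 * l)) {η : (C.thetaEnvData μ hC hS).PiYdd → MuN p N}
  (hη : η ∈ (C.thetaEnvData μ hC hS).thetaCocycles) (hN : (C.Huu.subgroupOf (M.GtpXu l)).Normal)
  {P : TopGroup.{0}} {T : TemperedCoverings (BadPlaceSetting.ofUnderline C μ hC hS hl hp2 hpl hζ hη) P}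

include hN in
/-- **IUTchII:Def2.3(i)** (kurims p.67) **`Def23_i_indices Dec W` over the print-level setting `BadPlaceSetting.ofUnderline` (p420095), for EVERY tower `W`**
(in particular abc-iut-L6-t19's GENUINE `ofPiCHat` / `ofCoverModel`) and every `Dec` whose `Π_{v▶}`, `Π_{v•}` are the decomposition subgroups cut
out by [IUTchI] §2 data `D▶`, `D•` (identifications `htri`, `hbul` — MERGE identification, explicit): MODULO per datum `Cor23Hyp`, [IUTchI] Cor 2.3 (iv)
and «`φ⁻¹ Π^tp_{X,ℍ} ⊄ incl Π_v`» ONLY — `incl Π_v ⊴ Π^tp_{X̲_v}(P)` (from the arithmetic normality `hN`, abc-iut-L6-t19 `range_incl_normal` +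
abc-iut-L2-t8 `ofUnderline_range_inclPlain`) and `[Π^tp_{X̲_v}(P) : incl Π_v] = l` (abc-iut-L6-t19 `index_range_incl` + abc-iut-L2-t8
`ofUnderline_index_eq`) being THEOREMS here.  PROVED. [claim: Mochizuki2012, status: disputed] -/
theorem def23_i_indices_ofUnderline_of_comap
    {E' : HodgeArakelov.EtaleThetaData (BadPlaceSetting.ofUnderline C μ hC hS hl hp2 hpl hζ hη).toThetaSetting P}
    (Dec : SubgraphDecomposition (BadPlaceSetting.ofUnderline C μ hC hS hl hp2 hpl hζ hη) T E') (W : PlusMinusTower T)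
    {Dtri Dbul : StableCurveTemperedData.{0}} (φtri : T.Xplain ≃* Dtri.PiTp) (φbul : T.Xplain ≃* Dbul.PiTp)
    (htri : Dec.Ptri = (Dtri.piTpXH.comap φtri.toMonoidHom).comap T.incl)
    (hbul : Dec.Pbullet = (Dbul.piTpXH.comap φbul.toMonoidHom).comap T.incl)
    (hHyp_tri : Dtri.Cor23Hyp) (h23iv_tri : Dtri.Cor23iv) (hnot_tri : ¬ Dtri.piTpXH.comap φtri.toMonoidHom ≤ T.incl.range)
    (hHyp_bul : Dbul.Cor23Hyp) (h23iv_bul : Dbul.Cor23iv) (hnot_bul : ¬ Dbul.piTpXH.comap φbul.toMonoidHom ≤ T.incl.range) :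
    Def23_i_indices Dec W := by
  refine PlusMinusTower.def23_i_indices_of_comap Dec W ?_ ?_ φtri φbul htri hbul hHyp_tri h23iv_tri hnot_tri
    hHyp_bul h23iv_bul hnot_bul
  · refine T.range_incl_normal ?_
    rw [BadPlaceSetting.ofUnderline_range_inclPlain]
    exact hN
  · rw [T.index_range_incl, BadPlaceSetting.ofUnderline_index_eq C μ hC hS hl hp2 hpl hζ hη]
    rfl

end Genuine

end Literature.IUT.HodgeArakelov
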